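import Mathlib.RingTheory.MvPolynomial.Homogeneous
import Mathlib.LinearAlgebra.Matrix.Adjugate
import Mathlib.Combinatorics.Pigeonhole
import Literature.Computability.AlgebraicComplexity.BILPS19MinrankVarieties
import Literature.Computability.AlgebraicComplexity.BILPS19KoszulFlatteningProofs
import HarnessLib

/-!
# Bläser–Ikenmeyer–Lysikov–Pandey–Schreyer 2019, Thm 27: equations for the minrank varieties
# from rectangular designs — proofs

Source: M. Bläser, C. Ikenmeyer, V. Lysikov, A. Pandey, F.-O. Schreyer, *Variety membership
testing, algebraic natural proofs, and geometric complexity theory*, arXiv:1911.02534 (bib key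
`BlaserIkenmeyerLysikovPandeySchreyer2019`), §7.3 "Equations from rectangular designs", flat
numbering of the held arXiv text (`lit read paper:arxiv-1911.02534`, chunks p0026:L9–p0027:L70):
Conjecture/statement 26 (`LRC(α, β)`), Thm 27 and its proof ("Construction of highest weight
vectors", "Evaluation via products of determinants", "The equations vanish on `𝓜_r`",
"Nontriviality of the equations").

This file DISCHARGES the named fact `BILPS2019_thm27` of
`Literature/Computability/AlgebraicComplexity/BILPS19MinrankVarieties.lean` (typed there WEAKER
than print: the conclusion retained is the existence of a nonzero homogeneous degree-`km` equation
of the minrank variety `𝓜_r ⊆ F^{k × m × n}`; the `GL × GL × GL`-isotypic type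
`((k × m), (m × k), (m × k))` of the representation it spans is not typed), following the printed
proof.

## The printed proof and how it is rendered

The paper takes `h := h_{k×m} ⊗ τ(h_{m×k}) ⊗ τ(h_{m×k}) ∈ (U ⊗ V ⊗ W)^{⊗D}`, `D = km`, projects
`P(h)` to the `S_D`-invariants to get `f`, and evaluates the degree-`D` form `T ↦ ⟨f, T^{⊗D}⟩`
through the formula (eq. `tripleprodofdets`, p0026:L70–78)

  `⟨P(h), x_1 ⊗ y_1 ⊗ z_1 ⊗ ⋯ ⊗ x_{mk} ⊗ y_{mk} ⊗ z_{mk}⟩ =`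
  `∏_{β} det(x | C_β) · ∏_{α} det(y | R_α) · ∏_{α} det(z | R_α)`,

where the `D = km` tensor positions are the cells `(α, β)` of a `k × m` array, `C_β` is the `β`-th
column (a `k × k` determinant of vectors of `U* = F^k`), `R_α` the `α`-th row (an `m × m`
determinant of vectors of `V* = F^m`, resp. the determinant "of the top `m × m` matrix" of vectors
of `W* = F^n`, `n ≥ m`, p0026:L63–66). Since `T^{⊗D}` is symmetric, `⟨f, T^{⊗D}⟩ = ⟨P(h), T^{⊗D}⟩`
(p0026:L54), and the rest of the printed proof only ever uses this evaluation formula. We therefore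
DEFINE the equation directly by the formula, written out with Leibniz' expansion of each
determinant: `rectDesignPoly k m n` is the sum over `σ ∈ S_k^m`, `π, ρ ∈ S_m^k` of
`sgn(σ) sgn(π) sgn(ρ) · ∏_{(α,β)} X_{(σ_β(α), π_α(β), ι(ρ_α(β)))}`, `ι : Fin m ↪ Fin n` the initial
segment. This is the polynomial `T ↦ ⟨P(h), T^{⊗km}⟩` of the paper; its highest-weight-vector
provenance (the isotypic type) is exactly the part of Thm 27 that the typed statement drops and is
NOT formalised here (no claim about the `GL × GL × GL`-module generated by `rectDesignPoly` is made).

Then, in the printed order: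
* `eval_rectDesignPoly_rankOne` — "Evaluation via products of determinants" (p0026:L51–p0027:L5):
  for `T = ∑_j a_j ⊗ b_j ⊗ c_j`, expanding `T^{⊗D}` over maps `J : [k] × [m] → {j}` gives
  `f(T) = ∑_J ∏_β det(a_{J(·,β)}) · ∏_α det(b_{J(α,·)}) · ∏_α det_top(c_{J(α,·)})`.
* `eval_rectDesignPoly_eq_zero_of_mem_minrankSet` — "The equations vanish on `𝓜_r`"
  (p0027:L7–L22): write `T = ∑_{ℓ ≠ ℓ₀} a_ℓ ⊗ (T g_ℓ) + a_{ℓ₀} ⊗ ∑_{i ≤ rk} b_i ⊗ c_i` in a basis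
  of `U` adapted to the witness `x = g_{ℓ₀}` of `T ∈ 𝓜_r` (rank factorisation of `Tx`); in every
  summand a column with a repeated `U`-label has determinant `0`, otherwise every column carries
  exactly one `ℓ₀`-label, so (`m > kr`, pigeonhole) some row carries `> r` of them, two of which
  carry the same `b_i`, and that row determinant is `0`.
* `eval_rectDesignPoly_designPt` — "Nontriviality of the equations" (p0027:L24–L70): at
  `T = ∑_{i ≤ m} u_i ⊗ e_i ⊗ e_i` with INDETERMINATE `u_i` (coefficients in `ℤ[X_{(i,a)}]`) the
  value is `∑_L det(L)` over the `k × m` Latin rectangles for `{u_1, …, u_m}`, i.e. the tree's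
  `latinRectSumPoly k m` (the `y`- and `z`-determinants of a row are the same signed permutation
  indicator, "a product of an even number of `−1`s equals `1`"); hence `LRC(k, m)` (the typed
  hypothesis `latinRectangleCondition k m`) gives `rectDesignPoly ≠ 0` in characteristic `0`
  (`rectDesignPoly_ne_zero`).
* `isHomogeneous_rectDesignPoly` (degree `km = D`) and the discharge `BILPS2019_thm27_holds`.

Deviations, disclosed: (1) the equation is defined by its evaluation formula rather than as the
image of a highest weight vector (see above); (2) the vanishing on `𝓜_r` is proved over every field
and the non-vanishing in every characteristic-`0` field — the typed hypotheses `IsAlgClosed F` and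
`k * r < n` are not used (the latter follows from `k * r < m ≤ n` anyway); (3) in addition (not in
the typed statement, recorded because the print notes it for `m = n`, p0026:L38: "for `m = n` this
means that the equation is a `GL(U) × GL(V) × GL(W)`-invariant polynomial") the semi-invariance
`f((A ⊗ B ⊗ C)·T) = det(A)^m det(B)^k det(C)^k f(T)` for `m = n` is proved
(`eval_rectDesignPoly_actTensor`). Honest framing (val-lit): a literature discharge; nothing here
bears on `VP ≠ VNP`.
-/

noncomputable section

open MvPolynomial Matrix Finset Equiv

namespace Literature.Computability.AlgebraicComplexity

namespace BILPS2019Thm27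

variable {R : Type*} [CommRing R]

/-! ### The equation `⟨P(h), T^{⊗km}⟩` as an explicit polynomial -/

/-- The product of the signs of a tuple of permutations (the sign of the Leibniz term of a product
of determinants). [cite: BlaserIkenmeyerLysikovPandeySchreyer2019, §7.3 (eq. tripleprodofdets)] -/
def permSignProd {ι : Type*} [Fintype ι] {l : ℕ} (τ : ι → Perm (Fin l)) : ℤ :=
  ∏ i, (Perm.sign (τ i) : ℤ)

variable (R) in
/-- **The degree-`km` equation of Thm 27**, i.e. the form `T ↦ ⟨P(h), T^{⊗km}⟩`,
`h = h_{k×m} ⊗ τ(h_{m×k}) ⊗ τ(h_{m×k})`, written out by the evaluation formula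
(eq. `tripleprodofdets`, p0026:L70) and Leibniz: the sum over `σ ∈ S_k^m` (one permutation per
column `C_β` of the `k × m` array of tensor positions), `π, ρ ∈ S_m^k` (one per row `R_α`, for the
`V`- and the `W`-leg) of `sgn(σ)sgn(π)sgn(ρ) · ∏_{(α,β)} X_{(σ_β(α), π_α(β), ι(ρ_α(β)))}`, where
`ι = Fin.castLE h : Fin m ↪ Fin n` realises "the determinant of the top `m × m` matrix"
(p0026:L66) on the `W`-leg. Variables `Fin k × Fin m × Fin n` = the coordinates `T_{abc}` of
`T ∈ U* ⊗ V* ⊗ W*` (the tree's `trilinearPt`). [cite: BlaserIkenmeyerLysikovPandeySchreyer2019, Thm. 27 (proof, §7.3)] -/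
def rectDesignPoly (k m n : ℕ) (h : m ≤ n) : MvPolynomial (Fin k × Fin m × Fin n) R :=
  ∑ σ : Fin m → Perm (Fin k), ∑ π : Fin k → Perm (Fin m), ∑ ρ : Fin k → Perm (Fin m),
    C ((permSignProd σ * permSignProd π * permSignProd ρ : ℤ) : R) *
      ∏ p : Fin k × Fin m, X (σ p.2 p.1, π p.1 p.2, Fin.castLE h (ρ p.1 p.2))

/-- `rectDesignPoly` is defined over `ℤ`: it commutes with change of coefficient ring.
[cite: BlaserIkenmeyerLysikovPandeySchreyer2019, Thm. 27 (proof, §7.3)] -/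
theorem map_rectDesignPoly {R' : Type*} [CommRing R'] (φ : R →+* R') (k m n : ℕ) (h : m ≤ n) :
    map φ (rectDesignPoly R k m n h) = rectDesignPoly R' k m n h := by
  simp only [rectDesignPoly, map_sum, map_mul, map_prod, map_intCast, map_X]

/-- **Thm 27, "in degree `km`"**: the equation is homogeneous of degree `k·m`
(`D := km`, p0026:L49). [cite: BlaserIkenmeyerLysikovPandeySchreyer2019, Thm. 27] -/
theorem isHomogeneous_rectDesignPoly (k m n : ℕ) (h : m ≤ n) :
    (rectDesignPoly R k m n h).IsHomogeneous (k * m) := by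
  classical
  rw [rectDesignPoly]
  refine IsHomogeneous.sum (univ : Finset (Fin m → Perm (Fin k))) _ (k * m) fun σ _ => ?_
  refine IsHomogeneous.sum (univ : Finset (Fin k → Perm (Fin m))) _ (k * m) fun π _ => ?_
  refine IsHomogeneous.sum (univ : Finset (Fin k → Perm (Fin m))) _ (k * m) fun ρ _ => ?_
  have hprod : (∏ p : Fin k × Fin m,
      (X (σ p.2 p.1, π p.1 p.2, Fin.castLE h (ρ p.1 p.2)) :
        MvPolynomial (Fin k × Fin m × Fin n) R)).IsHomogeneous (k * m) := by
    have hx := IsHomogeneous.prod (univ : Finset (Fin k × Fin m))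
      (fun p => (X (σ p.2 p.1, π p.1 p.2, Fin.castLE h (ρ p.1 p.2)) :
        MvPolynomial (Fin k × Fin m × Fin n) R)) (fun _ => 1) (fun p _ => isHomogeneous_X _ _)
    rwa [Finset.sum_const, smul_eq_mul, mul_one, Finset.card_univ, Fintype.card_prod,
      Fintype.card_fin, Fintype.card_fin] at hx
  have hC := (isHomogeneous_C (Fin k × Fin m × Fin n)
    ((permSignProd σ * permSignProd π * permSignProd ρ : ℤ) : R)).mul hprod
  rwa [zero_add] at hC

/-! ### Evaluation via products of determinants -/

/-- The `U`-leg factor of the evaluation formula for the column `C_β`: the `k × k` determinant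
`det(x_{(1,β)}, …, x_{(k,β)})` of the vectors sitting in column `β` (p0026:L70, first line).
[cite: BlaserIkenmeyerLysikovPandeySchreyer2019, §7.3 (eq. tripleprodofdets)] -/
def colDet {ι' : Type*} {k m : ℕ} (a : ι' → Fin k → R) (J : Fin k × Fin m → ι') (β : Fin m) : R :=
  det (Matrix.of fun i α : Fin k => a (J (α, β)) i)

/-- The `V`-leg factor for the row `R_α`: the `m × m` determinant `det(y_{(α,1)}, …, y_{(α,m)})`
(p0026:L70, second line). [cite: BlaserIkenmeyerLysikovPandeySchreyer2019, §7.3 (eq. tripleprodofdets)] -/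
def rowDet {ι' : Type*} {k m : ℕ} (b : ι' → Fin m → R) (J : Fin k × Fin m → ι') (α : Fin k) : R :=
  det (Matrix.of fun i β : Fin m => b (J (α, β)) i)

/-- The `W`-leg factor for the row `R_α`: "the determinant of the top `m × m` matrix of the `n × m`
matrix" `(z_{(α,1)}, …, z_{(α,m)})`, `n ≥ m` (p0026:L63–66, L70 third line).
[cite: BlaserIkenmeyerLysikovPandeySchreyer2019, §7.3 (eq. tripleprodofdets)] -/
def rowDetTop {ι' : Type*} {k m n : ℕ} (h : m ≤ n) (c : ι' → Fin n → R)
    (J : Fin k × Fin m → ι') (α : Fin k) : R :=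
  det (Matrix.of fun i β : Fin m => c (J (α, β)) (Fin.castLE h i))

/-- A triple sum of triple products is the product of the three sums. [folklore] -/
private theorem sum_sum_sum_mul_mul {ι₁ ι₂ ι₃ : Type*} [Fintype ι₁] [Fintype ι₂] [Fintype ι₃]
    (f : ι₁ → R) (g : ι₂ → R) (e : ι₃ → R) :
    ∑ x, ∑ y, ∑ z, f x * g y * e z = (∑ x, f x) * (∑ y, g y) * ∑ z, e z := by
  rw [Finset.sum_mul_sum, Finset.sum_mul]
  refine sum_congr rfl fun x _ => ?_
  rw [Finset.sum_mul_sum]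

/-- Leibniz for the `U`-leg: summing the signed column products over `σ ∈ S_k^m` gives the product
of the column determinants. [cite: BlaserIkenmeyerLysikovPandeySchreyer2019, §7.3 (eq. prodofdets)] -/
theorem sum_permSignProd_mul_prod_col {ι' : Type*} {k m : ℕ} (a : ι' → Fin k → R)
    (J : Fin k × Fin m → ι') :
    ∑ σ : Fin m → Perm (Fin k), ((permSignProd σ : ℤ) : R) *
        ∏ p : Fin k × Fin m, a (J p) (σ p.2 p.1) = ∏ β, colDet a J β := by
  classical
  have hσ : ∀ σ : Fin m → Perm (Fin k), ((permSignProd σ : ℤ) : R) *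
      ∏ p : Fin k × Fin m, a (J p) (σ p.2 p.1) =
        ∏ β, (((Perm.sign (σ β) : ℤ) : R) * ∏ α, a (J (α, β)) (σ β α)) := by
    intro σ
    rw [permSignProd, Int.cast_prod, Fintype.prod_prod_type_right, ← prod_mul_distrib]
  simp_rw [hσ]
  rw [← Fintype.prod_sum (fun β (τ : Perm (Fin k)) => ((Perm.sign τ : ℤ) : R) *
    ∏ α, a (J (α, β)) (τ α))]
  refine prod_congr rfl fun β _ => ?_
  rw [colDet, det_apply']
  rfl

/-- Leibniz for the `V`-leg: summing the signed row products over `π ∈ S_m^k` gives the product of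
the row determinants. [cite: BlaserIkenmeyerLysikovPandeySchreyer2019, §7.3 (eq. tripleprodofdets)] -/
theorem sum_permSignProd_mul_prod_row {ι' : Type*} {k m : ℕ} (b : ι' → Fin m → R)
    (J : Fin k × Fin m → ι') :
    ∑ π : Fin k → Perm (Fin m), ((permSignProd π : ℤ) : R) *
        ∏ p : Fin k × Fin m, b (J p) (π p.1 p.2) = ∏ α, rowDet b J α := by
  classical
  have hπ : ∀ π : Fin k → Perm (Fin m), ((permSignProd π : ℤ) : R) *
      ∏ p : Fin k × Fin m, b (J p) (π p.1 p.2) =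
        ∏ α, (((Perm.sign (π α) : ℤ) : R) * ∏ β, b (J (α, β)) (π α β)) := by
    intro π
    rw [permSignProd, Int.cast_prod, Fintype.prod_prod_type, ← prod_mul_distrib]
  simp_rw [hπ]
  rw [← Fintype.prod_sum (fun α (τ : Perm (Fin m)) => ((Perm.sign τ : ℤ) : R) *
    ∏ β, b (J (α, β)) (τ β))]
  refine prod_congr rfl fun α _ => ?_
  rw [rowDet, det_apply']
  rfl

/-- Leibniz for the `W`-leg (top `m × m` determinants).
[cite: BlaserIkenmeyerLysikovPandeySchreyer2019, §7.3 (eq. tripleprodofdets)] -/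
theorem sum_permSignProd_mul_prod_rowTop {ι' : Type*} {k m n : ℕ} (h : m ≤ n)
    (c : ι' → Fin n → R) (J : Fin k × Fin m → ι') :
    ∑ ρ : Fin k → Perm (Fin m), ((permSignProd ρ : ℤ) : R) *
        ∏ p : Fin k × Fin m, c (J p) (Fin.castLE h (ρ p.1 p.2)) = ∏ α, rowDetTop h c J α := by
  classical
  have hρ : ∀ ρ : Fin k → Perm (Fin m), ((permSignProd ρ : ℤ) : R) *
      ∏ p : Fin k × Fin m, c (J p) (Fin.castLE h (ρ p.1 p.2)) =
        ∏ α, (((Perm.sign (ρ α) : ℤ) : R) * ∏ β, c (J (α, β)) (Fin.castLE h (ρ α β))) := by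
    intro ρ
    rw [permSignProd, Int.cast_prod, Fintype.prod_prod_type, ← prod_mul_distrib]
  simp_rw [hρ]
  rw [← Fintype.prod_sum (fun α (τ : Perm (Fin m)) => ((Perm.sign τ : ℤ) : R) *
    ∏ β, c (J (α, β)) (Fin.castLE h (τ β)))]
  refine prod_congr rfl fun α _ => ?_
  rw [rowDetTop, det_apply']
  rfl

/-- **"Evaluation via products of determinants"** (p0026:L51–p0027:L5): if
`T = ∑_j a_j ⊗ b_j ⊗ c_j` (any finite family of rank-one tensors), then expanding `T^{⊗km}` over
the maps `J : [k] × [m] → {j}` and using eq. `tripleprodofdets` on each summand,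
`⟨P(h), T^{⊗km}⟩ = ∑_J ∏_β det(a_{J(·,β)}) · ∏_α det(b_{J(α,·)}) · ∏_α det_top(c_{J(α,·)})`.
[cite: BlaserIkenmeyerLysikovPandeySchreyer2019, §7.3 (evaluation via products of determinants)] -/
theorem eval_rectDesignPoly_rankOne {ι' : Type*} [Fintype ι'] [DecidableEq ι'] {k m n : ℕ}
    (h : m ≤ n) (a : ι' → Fin k → R) (b : ι' → Fin m → R) (c : ι' → Fin n → R)
    (T : Fin k × Fin m × Fin n → R) (hT : ∀ p, T p = ∑ j, a j p.1 * b j p.2.1 * c j p.2.2) :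
    eval T (rectDesignPoly R k m n h) =
      ∑ J : Fin k × Fin m → ι',
        (∏ β, colDet a J β) * (∏ α, rowDet b J α) * ∏ α, rowDetTop h c J α := by
  classical
  have hexp : ∀ (σ : Fin m → Perm (Fin k)) (π ρ : Fin k → Perm (Fin m)),
      (∏ p : Fin k × Fin m, T (σ p.2 p.1, π p.1 p.2, Fin.castLE h (ρ p.1 p.2))) =
        ∑ J : Fin k × Fin m → ι', ∏ p : Fin k × Fin m,
          a (J p) (σ p.2 p.1) * b (J p) (π p.1 p.2) * c (J p) (Fin.castLE h (ρ p.1 p.2)) := by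
    intro σ π ρ
    simp_rw [hT]
    exact Fintype.prod_sum (fun (p : Fin k × Fin m) (j : ι') =>
      a j (σ p.2 p.1) * b j (π p.1 p.2) * c j (Fin.castLE h (ρ p.1 p.2)))
  calc eval T (rectDesignPoly R k m n h)
      = ∑ σ : Fin m → Perm (Fin k), ∑ π : Fin k → Perm (Fin m), ∑ ρ : Fin k → Perm (Fin m),
          ((permSignProd σ * permSignProd π * permSignProd ρ : ℤ) : R) *
            ∑ J : Fin k × Fin m → ι', ∏ p : Fin k × Fin m,
              a (J p) (σ p.2 p.1) * b (J p) (π p.1 p.2) * c (J p) (Fin.castLE h (ρ p.1 p.2)) := by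
        simp only [rectDesignPoly, map_sum, map_mul, eval_C, map_prod, eval_X, hexp]
    _ = ∑ σ : Fin m → Perm (Fin k), ∑ π : Fin k → Perm (Fin m), ∑ ρ : Fin k → Perm (Fin m),
          ∑ J : Fin k × Fin m → ι',
            (((permSignProd σ : ℤ) : R) * ∏ p : Fin k × Fin m, a (J p) (σ p.2 p.1)) *
            (((permSignProd π : ℤ) : R) * ∏ p : Fin k × Fin m, b (J p) (π p.1 p.2)) *
            (((permSignProd ρ : ℤ) : R) *
              ∏ p : Fin k × Fin m, c (J p) (Fin.castLE h (ρ p.1 p.2))) := by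
        refine sum_congr rfl fun σ _ => sum_congr rfl fun π _ => sum_congr rfl fun ρ _ => ?_
        rw [Finset.mul_sum]
        refine sum_congr rfl fun J _ => ?_
        rw [prod_mul_distrib, prod_mul_distrib, Int.cast_mul, Int.cast_mul]
        ring
    _ = ∑ J : Fin k × Fin m → ι',
          ∑ σ : Fin m → Perm (Fin k), ∑ π : Fin k → Perm (Fin m), ∑ ρ : Fin k → Perm (Fin m),
            (((permSignProd σ : ℤ) : R) * ∏ p : Fin k × Fin m, a (J p) (σ p.2 p.1)) *
            (((permSignProd π : ℤ) : R) * ∏ p : Fin k × Fin m, b (J p) (π p.1 p.2)) *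
            (((permSignProd ρ : ℤ) : R) *
              ∏ p : Fin k × Fin m, c (J p) (Fin.castLE h (ρ p.1 p.2))) := by
        symm
        rw [Finset.sum_comm]
        refine sum_congr rfl fun σ _ => ?_
        rw [Finset.sum_comm]
        refine sum_congr rfl fun π _ => ?_
        rw [Finset.sum_comm]
    _ = ∑ J : Fin k × Fin m → ι',
          (∏ β, colDet a J β) * (∏ α, rowDet b J α) * ∏ α, rowDetTop h c J α := by
        refine sum_congr rfl fun J _ => ?_
        rw [sum_sum_sum_mul_mul, sum_permSignProd_mul_prod_col, sum_permSignProd_mul_prod_row,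
          sum_permSignProd_mul_prod_rowTop]

/-! ### The equations vanish on `𝓜_r` -/

/-- **"The equations vanish on `𝓜_r`"** (p0027:L7–L22): if `T ∈ U* ⊗ V* ⊗ W*` has a nonzero
`x ∈ U` with `rk(Tx) ≤ r` and `m > kr`, then `⟨P(h), T^{⊗km}⟩ = 0`. Printed argument: expand `T`
in a basis of `U*` adapted to `x` into `(k−1)mn + rk` rank-one tensors and `T^{⊗km}` accordingly;
in eq. `tripleprodofdets` a nonzero column determinant forces exactly one `a_k`-label per column
`C_β`, a nonzero row determinant at most `r` of them per row `R_α`, "therefore, since `m > kr`,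
the pigeonhole principle implies that (tripleprodofdets) is zero". Over every field.
[cite: BlaserIkenmeyerLysikovPandeySchreyer2019, Thm. 27 (proof: the equations vanish on 𝓜_r)] -/
theorem eval_rectDesignPoly_eq_zero_of_mem_minrankSet {F : Type*} [Field F] {k m n r : ℕ}
    (h : m ≤ n) (hkr : k * r < m) {T : Fin k → Fin m → Fin n → F}
    (hT : T ∈ (minrankSet F r : Set (Fin k → Fin m → Fin n → F))) :
    eval (trilinearPt T) (rectDesignPoly F k m n h) = 0 := by
  classical
  obtain ⟨x, hx, hrk⟩ := hT
  obtain ⟨a₀, ha₀⟩ : ∃ a₀, x a₀ ≠ 0 := Function.ne_iff.mp hx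
  -- rank factorisation of the slice `Tx` through `F^{rk(Tx)}`
  obtain ⟨B, Cm, hBC⟩ := exists_mul_eq_of_rank (contract3 T x)
  -- a basis of `U` adapted to `x`: the columns of `G` (column `a₀` is `x`), dual basis = rows of `G⁻¹`
  set G : Matrix (Fin k) (Fin k) F := (1 : Matrix (Fin k) (Fin k) F).updateCol a₀ x with hG
  have hGdet : G.det = x a₀ := by
    rw [hG, ← cramer_apply, cramer_one]
    rfl
  have hGunit : IsUnit G.det := by
    rw [hGdet]
    exact isUnit_iff_ne_zero.mpr ha₀
  have hGa₀ : (fun a' => G a' a₀) = x := funext fun a' => by simp [hG]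
  -- `T_{abc} = ∑_ℓ (G⁻¹)_{ℓ a} · (T G_{·ℓ})_{bc}`
  have hdecomp : ∀ a b c, T a b c = ∑ ℓ, G⁻¹ ℓ a * contract3 T (fun a' => G a' ℓ) b c := by
    intro a b c
    have hmul : ∀ a', ∑ ℓ, G⁻¹ ℓ a * (G a' ℓ * T a' b c) = (G * G⁻¹) a' a * T a' b c := by
      intro a'
      rw [Matrix.mul_apply, Finset.sum_mul]
      exact sum_congr rfl fun ℓ _ => by ring
    simp only [contract3_apply, Finset.mul_sum]
    rw [Finset.sum_comm]
    simp_rw [hmul, Matrix.mul_nonsing_inv _ hGunit, Matrix.one_apply, ite_mul, one_mul, zero_mul,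
      Finset.sum_ite_eq', Finset.mem_univ, if_true]
  -- the rank-one expansion of `T`: index type `ι'`
  let ι' := (↥({a₀}ᶜ : Finset (Fin k)) × Fin m × Fin n) ⊕ Fin (contract3 T x).rank
  let av : ι' → Fin k → F := Sum.elim (fun q a => G⁻¹ q.1.1 a) (fun _ a => G⁻¹ a₀ a)
  let bv : ι' → Fin m → F :=
    Sum.elim (fun q i => if i = q.2.1 then contract3 T (fun a' => G a' q.1.1) q.2.1 q.2.2 else 0)
      (fun t i => B i t)
  let cv : ι' → Fin n → F := Sum.elim (fun q j => if j = q.2.2 then 1 else 0) (fun t j => Cm t j)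
  have hrank1 : ∀ p : Fin k × Fin m × Fin n,
      trilinearPt T p = ∑ j, av j p.1 * bv j p.2.1 * cv j p.2.2 := by
    rintro ⟨a, b, c⟩
    change T a b c = _
    rw [hdecomp, Fintype.sum_sum_type, add_comm, Fintype.sum_eq_add_sum_compl a₀]
    congr 1
    · -- the `a₀`-slice `Tx = B Cm`
      simp only [av, bv, cv, Sum.elim_inr, hGa₀, ← hBC, Matrix.mul_apply, Finset.mul_sum]
      exact sum_congr rfl fun t _ => by ring
    · -- the other slices, expanded entrywise
      rw [← Finset.sum_coe_sort ({a₀}ᶜ : Finset (Fin k))]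
      simp only [av, bv, cv, Sum.elim_inl, Fintype.sum_prod_type, mul_ite, mul_one, mul_zero,
        Finset.sum_ite_eq, Finset.mem_univ, if_true]
  rw [eval_rectDesignPoly_rankOne h av bv cv _ hrank1]
  refine Finset.sum_eq_zero fun J _ => ?_
  -- the `U`-label of a rank-one term
  let lab : ι' → Fin k := Sum.elim (fun q => q.1.1) (fun _ => a₀)
  have hav : ∀ j i, av j i = G⁻¹ (lab j) i := by
    rintro (q | t) i <;> rfl
  have hlab : ∀ j, lab j = a₀ → ∃ t, j = Sum.inr t := by
    rintro (q | t) hq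
    · have hq1 := q.1.2
      rw [Finset.mem_compl, Finset.mem_singleton] at hq1
      exact absurd hq hq1
    · exact ⟨t, rfl⟩
  by_cases hinj : ∀ β, Function.Injective fun α => lab (J (α, β))
  · -- every column carries an `a₀`-label: pigeonhole over the rows
    have hsurj : ∀ β, ∃ α, lab (J (α, β)) = a₀ := fun β =>
      (Finite.injective_iff_surjective.mp (hinj β)) a₀
    choose αof hαof using hsurj
    set S := (univ : Finset (Fin k × Fin m)).filter (fun p => ∃ t, J p = Sum.inr t) with hS
    have hmemS : ∀ β, (αof β, β) ∈ S := fun β => by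
      rw [hS, mem_filter]
      exact ⟨mem_univ _, hlab _ (hαof β)⟩
    have hcardS : m ≤ S.card := by
      have hle := Finset.card_le_card_of_injOn (s := (univ : Finset (Fin m))) (t := S)
        (fun β => (αof β, β)) (fun β _ => hmemS β)
        (fun β₁ _ β₂ _ hβ => congrArg Prod.snd hβ)
      simpa using hle
    obtain ⟨α, -, hα⟩ := Finset.exists_lt_card_fiber_of_mul_lt_card_of_maps_to
      (s := S) (t := (univ : Finset (Fin k))) (f := Prod.fst) (n := r)
      (fun _ _ => mem_univ _) (by simpa using hkr.trans_le hcardS)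
    obtain ⟨p, hp, p', hp', hne, hJ⟩ := Finset.exists_ne_map_eq_of_card_lt_of_maps_to
      (s := S.filter fun q => q.1 = α)
      (t := (univ : Finset (Fin (contract3 T x).rank)).image Sum.inr) (f := J)
      (lt_of_le_of_lt (card_image_le.trans (by simpa using hrk)) hα)
      (fun q hq => by
        obtain ⟨hqS, -⟩ := mem_filter.mp hq
        obtain ⟨-, t, ht⟩ := mem_filter.mp hqS
        exact mem_image.mpr ⟨t, mem_univ _, ht.symm⟩)
    have hp1 : p.1 = α := (mem_filter.mp hp).2
    have hp'1 : p'.1 = α := (mem_filter.mp hp').2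
    have hββ' : p.2 ≠ p'.2 := fun hβ => hne (Prod.ext (hp1.trans hp'1.symm) hβ)
    have hrow : rowDet bv J α = 0 := by
      refine det_zero_of_column_eq hββ' fun i => ?_
      have e1 : (α, p.2) = p := by rw [← hp1]
      have e2 : (α, p'.2) = p' := by rw [← hp'1]
      simp only [Matrix.of_apply, e1, e2, hJ]
    rw [Finset.prod_eq_zero (mem_univ α) hrow, mul_zero, zero_mul]
  · -- a column with a repeated `U`-label has determinant `0`
    push Not at hinj
    obtain ⟨β, hβ⟩ := hinj
    obtain ⟨α₁, α₂, hlab₁₂, hne⟩ := Function.not_injective_iff.mp hβ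
    have hcol : colDet av J β = 0 := by
      refine det_zero_of_column_eq hne fun i => ?_
      simp only [Matrix.of_apply, hav]
      exact congrArg (fun ℓ => G⁻¹ ℓ i) hlab₁₂
    rw [Finset.prod_eq_zero (mem_univ β) hcol, zero_mul, zero_mul]

/-! ### Nontriviality of the equations -/

/-- The `0/1` matrix of a self-map `g` of `Fin m` (column `β` = `e_{g β}`): the common value of the
`V`- and `W`-row determinants' matrices at the design tensor (p0027:L62–65).
[cite: BlaserIkenmeyerLysikovPandeySchreyer2019, Thm. 27 (proof: nontriviality)] -/
def indicatorMatrix {m : ℕ} (g : Fin m → Fin m) : Matrix (Fin m) (Fin m) R :=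
  Matrix.of fun i β => if i = g β then 1 else 0

/-- "each determinant of `y`-variables has value `±1` … and the signs of the `i`-th determinant of
`y`-values and the `i`-th determinant of `z`-values coincide. Since a product of an even number
of `−1`s equals `1`" (p0027:L62–66): `det(P_g)² = 1` if `g` is a bijection, and `det(P_g) = 0`
otherwise (two equal columns). [cite: BlaserIkenmeyerLysikovPandeySchreyer2019, Thm. 27 (proof: nontriviality)] -/
theorem det_indicatorMatrix_mul_self {m : ℕ} (g : Fin m → Fin m) :
    det (indicatorMatrix (R := R) g) * det (indicatorMatrix (R := R) g) =
      if Function.Bijective g then 1 else 0 := by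
  classical
  by_cases hg : Function.Injective g
  · have hbij : Function.Bijective g := ⟨hg, Finite.injective_iff_surjective.mp hg⟩
    rw [if_pos hbij]
    set σ : Perm (Fin m) := Equiv.ofBijective g hbij with hσ
    have hP : indicatorMatrix (R := R) g = (1 : Matrix (Fin m) (Fin m) R).submatrix id σ := by
      ext i β
      simp [indicatorMatrix, Matrix.one_apply, hσ]
    rw [hP, det_permute', det_one, mul_one, ← Int.cast_mul, ← Units.val_mul, Int.units_mul_self,
      Units.val_one, Int.cast_one]
  · have hnb : ¬ Function.Bijective g := fun hb => hg hb.1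
    rw [if_neg hnb]
    obtain ⟨β₁, β₂, hg₁₂, hne⟩ := Function.not_injective_iff.mp hg
    have h0 : det (indicatorMatrix (R := R) g) = 0 :=
      det_zero_of_column_eq hne fun i => by simp [indicatorMatrix, hg₁₂]
    rw [h0, mul_zero]

/-- A column with a repeated label kills the column-determinant product `det(L)`
(p0027:L57: "if there exist `j` and `j'` in `C_β` with `x_j = x_{j'}`, then (tripleprodofdets)
also vanishes"): `colDetPoly R = 0` unless every column of `R` is injective.
[cite: BlaserIkenmeyerLysikovPandeySchreyer2019, Thm. 27 (proof: nontriviality)] -/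
theorem colDetPoly_eq_zero_of_not_injective {k m : ℕ} (Rm : Fin k → Fin m → Fin m) (j : Fin m)
    (hj : ¬ Function.Injective fun p => Rm p j) : colDetPoly Rm = 0 := by
  classical
  obtain ⟨p₁, p₂, h₁₂, hne⟩ := Function.not_injective_iff.mp hj
  refine Finset.prod_eq_zero (Finset.mem_univ j) ?_
  exact det_zero_of_column_eq hne fun a => by
    simp only [Matrix.of_apply]
    exact congrArg (fun v => (X (v, a) : MvPolynomial (Fin m × Fin k) ℤ)) h₁₂

/-- The coordinates of the design tensor `T = ∑_{i ≤ m} u_i ⊗ e_i ⊗ e_i` (p0027:L31) with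
INDETERMINATE vectors `u_i = (X_{(i,a)})_a`: `T_{(a,b,c)} = X_{(b,a)}` if `c = ι(b)`, else `0`,
written as the rank-one sum it is. [cite: BlaserIkenmeyerLysikovPandeySchreyer2019, Thm. 27 (proof: nontriviality)] -/
def designPt (k m n : ℕ) (h : m ≤ n) :
    Fin k × Fin m × Fin n → MvPolynomial (Fin m × Fin k) ℤ :=
  fun p => ∑ j : Fin m, X (j, p.1) * (if p.2.1 = j then 1 else 0) *
    (if p.2.2 = Fin.castLE h j then 1 else 0)

/-- **"Nontriviality of the equations"** (p0027:L24–L70): at the design tensor with indeterminate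
`u`, "the contraction (tensorcontractionfI) equals `∑_L det(L)`, where the sum is over all Latin
Rectangles for `𝒰`" — in the tree's vocabulary, the value of `rectDesignPoly` (coefficients in
`ℤ[X_{(i,a)}]`) at `designPt` is `latinRectSumPoly k m`.
[cite: BlaserIkenmeyerLysikovPandeySchreyer2019, Thm. 27 (proof: nontriviality)] -/
theorem eval_rectDesignPoly_designPt (k m n : ℕ) (h : m ≤ n) :
    eval (designPt k m n h) (rectDesignPoly (MvPolynomial (Fin m × Fin k) ℤ) k m n h) =
      latinRectSumPoly k m := by
  classical
  let S := MvPolynomial (Fin m × Fin k) ℤ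
  let ua : Fin m → Fin k → S := fun j a => X (j, a)
  let ub : Fin m → Fin m → S := fun j i => if i = j then 1 else 0
  let uc : Fin m → Fin n → S := fun j i => if i = Fin.castLE h j then 1 else 0
  have hT : ∀ p, designPt k m n h p = ∑ j, ua j p.1 * ub j p.2.1 * uc j p.2.2 := fun p => rfl
  rw [eval_rectDesignPoly_rankOne h ua ub uc _ hT]
  -- identify the three factors
  have hrow : ∀ (J : Fin k × Fin m → Fin m) (α : Fin k),
      rowDet ub J α = det (indicatorMatrix (R := S) fun β => J (α, β)) := fun J α => rfl
  have htop : ∀ (J : Fin k × Fin m → Fin m) (α : Fin k),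
      rowDetTop h uc J α = det (indicatorMatrix (R := S) fun β => J (α, β)) := by
    intro J α
    simp only [rowDetTop, indicatorMatrix, uc, (Fin.castLE_injective h).eq_iff]
  have hcol : ∀ J : Fin k × Fin m → Fin m,
      ∏ β, colDet ua J β = colDetPoly (fun α β => J (α, β)) := fun J => rfl
  have hyz : ∀ J : Fin k × Fin m → Fin m,
      (∏ α, rowDet ub J α) * (∏ α, rowDetTop h uc J α) =
        if ∀ α, Function.Bijective (fun β => J (α, β)) then 1 else 0 := by
    intro J
    simp_rw [hrow, htop, ← prod_mul_distrib, det_indicatorMatrix_mul_self]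
    rw [Finset.prod_boole]
    simp
  simp_rw [mul_assoc, hyz, hcol, mul_boole]
  -- compare with the Latin-rectangle sum
  rw [latinRectSumPoly, Finset.sum_filter]
  rw [← Fintype.sum_equiv (Equiv.curry (Fin k) (Fin m) (Fin m)).symm
    (fun Rm : Fin k → Fin m → Fin m => if Kumar2015.IsLatinRect Rm then colDetPoly Rm else 0)
    (fun J : Fin k × Fin m → Fin m =>
      if ∀ α, Function.Bijective (fun β => J (α, β)) then colDetPoly (fun α β => J (α, β)) else 0)
    (fun Rm => ?_)]
  -- pointwise: a row-bijective array with a non-injective column contributes `0`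
  change (if Kumar2015.IsLatinRect Rm then colDetPoly Rm else 0) =
    if ∀ α, Function.Bijective (Rm α) then colDetPoly Rm else 0
  by_cases hL : Kumar2015.IsLatinRect Rm
  · rw [if_pos hL, if_pos hL.1]
  · rw [if_neg hL]
    by_cases hrows : ∀ α, Function.Bijective (Rm α)
    · rw [if_pos hrows]
      have hcols : ¬ ∀ j, Function.Injective fun p => Rm p j := fun hc => hL ⟨hrows, hc⟩
      push Not at hcols
      obtain ⟨j, hj⟩ := hcols
      exact (colDetPoly_eq_zero_of_not_injective Rm j hj).symm
    · rw [if_neg hrows]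

/-- **Thm 27, nontriviality**: "if `LRC(k, m)`, then there exists a tensor `t` for which
(tensorcontractionfI) is nonzero, which proves that our equations are not just the zero function"
(p0027:L24–26) — over any field of characteristic `0` (where the generic non-vanishing of the
integer polynomial `∑_L det(L)` transfers).
[cite: BlaserIkenmeyerLysikovPandeySchreyer2019, Thm. 27 (proof: nontriviality)] -/
theorem rectDesignPoly_ne_zero {F : Type*} [Field F] [CharZero F] {k m n : ℕ} (h : m ≤ n)
    (hL : latinRectangleCondition k m) : rectDesignPoly F k m n h ≠ 0 := by
  intro h0
  apply hL
  have hZ : rectDesignPoly ℤ k m n h = 0 := by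
    apply MvPolynomial.map_injective (Int.castRingHom F) Int.cast_injective
    rw [map_rectDesignPoly, h0, map_zero]
  rw [← eval_rectDesignPoly_designPt k m n h,
    ← map_rectDesignPoly (Int.castRingHom (MvPolynomial (Fin m × Fin k) ℤ)) k m n h, hZ, map_zero,
    map_zero]

/-! ### Semi-invariance for `m = n` -/

/-- A linear map on the `U`-leg multiplies each column determinant by its determinant.
[cite: BlaserIkenmeyerLysikovPandeySchreyer2019, Thm. 27 (invariance remark for m = n)] -/
theorem colDet_mulVec {ι' : Type*} {k m : ℕ} (A : Matrix (Fin k) (Fin k) R) (a : ι' → Fin k → R)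
    (J : Fin k × Fin m → ι') (β : Fin m) :
    colDet (fun j => A *ᵥ a j) J β = A.det * colDet a J β := by
  rw [colDet, colDet, ← det_mul]
  congr 1

/-- A linear map on the `V`-leg multiplies each row determinant by its determinant.
[cite: BlaserIkenmeyerLysikovPandeySchreyer2019, Thm. 27 (invariance remark for m = n)] -/
theorem rowDet_mulVec {ι' : Type*} {k m : ℕ} (B : Matrix (Fin m) (Fin m) R) (b : ι' → Fin m → R)
    (J : Fin k × Fin m → ι') (α : Fin k) :
    rowDet (fun j => B *ᵥ b j) J α = B.det * rowDet b J α := by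
  rw [rowDet, rowDet, ← det_mul]
  congr 1

/-- For `n = m` ("top `m × m` matrix" = the whole matrix) a linear map on the `W`-leg multiplies
each row determinant by its determinant.
[cite: BlaserIkenmeyerLysikovPandeySchreyer2019, Thm. 27 (invariance remark for m = n)] -/
theorem rowDetTop_mulVec {ι' : Type*} {k m : ℕ} (h : m ≤ m) (C : Matrix (Fin m) (Fin m) R)
    (c : ι' → Fin m → R) (J : Fin k × Fin m → ι') (α : Fin k) :
    rowDetTop h (fun j => C *ᵥ c j) J α = C.det * rowDetTop h c J α := by
  rw [rowDetTop, rowDetTop, ← det_mul]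
  congr 1

/-- **"Note that for `m = n` this means that the equation is an `GL(U) × GL(V) × GL(W)`-invariant
polynomial"** (p0026:L38, i.e. invariant under `SL × SL × SL`): for `m = n` the equation is a
semi-invariant of weight `(det^m, det^k, det^k)`,
`⟨P(h), ((A ⊗ B ⊗ C)·T)^{⊗km}⟩ = det(A)^m det(B)^k det(C)^k ⟨P(h), T^{⊗km}⟩`, for ALL square
matrices `A, B, C` over any commutative ring (action = the tree's `actTensor`). Not part of the
typed statement; recorded as printed content of Thm 27.
[cite: BlaserIkenmeyerLysikovPandeySchreyer2019, Thm. 27 (invariance remark for m = n)] -/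
theorem eval_rectDesignPoly_actTensor {k m : ℕ} (h : m ≤ m) (A : Matrix (Fin k) (Fin k) R)
    (B C : Matrix (Fin m) (Fin m) R) (T : Fin k → Fin m → Fin m → R) :
    eval (trilinearPt (actTensor A B C T)) (rectDesignPoly R k m m h) =
      A.det ^ m * B.det ^ k * C.det ^ k * eval (trilinearPt T) (rectDesignPoly R k m m h) := by
  classical
  -- the tautological rank-one expansion `T = ∑_{(a,b,c)} (T_{abc} e_a) ⊗ e_b ⊗ e_c`
  let a : Fin k × Fin m × Fin m → Fin k → R := fun j i => if i = j.1 then T j.1 j.2.1 j.2.2 else 0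
  let b : Fin k × Fin m × Fin m → Fin m → R := fun j i => if i = j.2.1 then 1 else 0
  let c : Fin k × Fin m × Fin m → Fin m → R := fun j i => if i = j.2.2 then 1 else 0
  have hT : ∀ p, trilinearPt T p = ∑ j, a j p.1 * b j p.2.1 * c j p.2.2 := by
    rintro ⟨a', b', c'⟩
    change T a' b' c' = _
    rw [Fintype.sum_eq_single (a', b', c') (fun j hj => ?_)]
    · simp [a, b, c]
    · by_cases h1 : a' = j.1
      · by_cases h2 : b' = j.2.1
        · have h3 : c' ≠ j.2.2 := fun h3 => hj (by rw [h1, h2, h3])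
          simp [c, h3]
        · simp [b, h2]
      · simp [a, h1]
  have hact : ∀ p, trilinearPt (actTensor A B C T) p =
      ∑ j, (A *ᵥ a j) p.1 * (B *ᵥ b j) p.2.1 * (C *ᵥ c j) p.2.2 := by
    rintro ⟨a', b', c'⟩
    change actTensor A B C T a' b' c' = _
    simp only [actTensor_apply, Matrix.mulVec, dotProduct, a, b, c, mul_ite, mul_one, mul_zero,
      Finset.sum_ite_eq', Finset.mem_univ, if_true, Fintype.sum_prod_type]
    exact sum_congr rfl fun _ _ => sum_congr rfl fun _ _ => sum_congr rfl fun _ _ => by ring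
  rw [eval_rectDesignPoly_rankOne h _ _ _ _ hact, eval_rectDesignPoly_rankOne h a b c _ hT,
    Finset.mul_sum]
  refine sum_congr rfl fun J _ => ?_
  simp_rw [colDet_mulVec, rowDet_mulVec, rowDetTop_mulVec, prod_mul_distrib, prod_const,
    Finset.card_univ, Fintype.card_fin]
  ring

end BILPS2019Thm27

/-! ### The discharge -/

open BILPS2019Thm27 in
/-- **BILPS Thm 27 (equations from rectangular designs), as typed — DISCHARGED.** "Let `m ≤ n`.
If `m, n > kr` and if `LRC(k, m)` holds, then there exists an irreducible representation of
nontrivial equations for `𝓜_r` in degree `km` …" (p0026:L36); typed conclusion (weaker than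
print): a nonzero homogeneous degree-`km` equation of `𝓜_r` exists. Witness: `rectDesignPoly`
(the paper's `⟨P(h), T^{⊗km}⟩`); nonzero by `rectDesignPoly_ne_zero` (LRC), homogeneous by
`isHomogeneous_rectDesignPoly`, vanishing on `𝓜_r` by
`eval_rectDesignPoly_eq_zero_of_mem_minrankSet` (`m > kr`). The hypotheses `IsAlgClosed F` and
`k * r < n` of the typed statement are not needed.
[cite: BlaserIkenmeyerLysikovPandeySchreyer2019, Thm. 27] -/
theorem BILPS2019_thm27_holds : BILPS2019_thm27 := by
  intro F _ _ _ k m n r hmn hkrm _ hL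
  exact ⟨rectDesignPoly F k m n hmn, rectDesignPoly_ne_zero hmn hL,
    isHomogeneous_rectDesignPoly k m n hmn,
    fun T hT => eval_rectDesignPoly_eq_zero_of_mem_minrankSet hmn hkrm hT⟩

end Literature.Computability.AlgebraicComplexity
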